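import Mathlib
import Summits.Ventures.HodgeRepro.Tier4.Common.AdelicDefs
import Summits.Ventures.HodgeRepro.Tier4.Line1.PlaneDefs
import Summits.Ventures.HodgeRepro.Tier4.Line1.TorusElement
import Summits.Ventures.HodgeRepro.Tier4.Line1.TorusPlaneData
import Summits.Ventures.HodgeRepro.Tier4.Line1.TorusCocompact

/-!
# Tier4/Line1/TorusPair — LINE L1, (I0-R) part 1: the pair of scalars of a torus element, read off the conjugated
matrix (the two `U(1)` factors of `T = U(W₀) × U(W₁)` as functions of the element)

Blind re-derivation cell `pub-hodge-repro`, Tier 4 «prove the step» (README §9–§10), seat t4-L1-p2 (gen 3), LINE L1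
(the relative-trace-formula line), cut (I0-R) «the character objects» (t4-plan-1 g2, S13462 (6)), part 1 of 2 (part 2 =
`Tier4/Line1/CornerCharacters.lean`).  Target tree path `lean/Summits/Ventures/HodgeRepro/Tier4/Line1/TorusPair.lean`.
Imports: typer-2's `AdelicDefs` (the plane `PlaneData k`, `U(W)(𝔸_k)`, `commutant`, `rationalPoints`), the line's
`PlaneDefs`, t4-L1-p5's `TorusElement` / `TorusPlaneData` / `TorusCocompact` (the torus data `TorusData k`, the adapted
basis `S`, `tmat`, `blockScalar`, `omegaJ`, `torusElt`, `exists_pair_of_mem`, `torusElt_mul`).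

WHAT IS DEFINED AND PROVED (Mathlib + the named modules only, no printed input).  For the torus data `D` of a
projector pair (`hDB hDOm hDP` as in TorusCocompact) and `g ∈ U(W)(𝔸_k)`:
* `conjMat D g = S⁻¹ · gᵀ · S` and `pairOf D g` = the pair of scalars `(x, y, x′, y′)` READ OFF `conjMat D g` at the
  four positions where `blockScalar d x y x′ y′` carries its entries — no choice is involved;
* `pairOf_torusElt : pairOf D (torusElt D … ρ) = ρ`, and every element of the torus `commutant (P 0) ⊓ commutant (P 1)`
  is the torus element of its own pair (`eq_torusElt_pairOf`, from p5's `exists_pair_of_mem`), of norm one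
  (`isNormOne_pairOf`);
* `pairOf_mul`: the pair of a product is the componentwise product `pmul` of the pairs;
* `continuous_pairOf`;
* `pairOf_rational`: the pair of a RATIONAL torus element is rational — `torus_scalar_of_isometry` over `k` itself, the
  identities over `k` recovered from the adelic ones by the injectivity of `k → 𝔸_k`;
* `pairOf_of_scalar`: the pair of an `E′_𝔸`-scalar `a·1 + b·Ω` is `(a, b, a, b)` (`S⁻¹ Ωᵀ S = omegaJ d`).

Nothing here says anything about the status of the Hodge conjecture for CM abelian varieties, which is NOT proved
(HC_CM is NOT proved by anyone in this repository).
-/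

set_option autoImplicit false

noncomputable section

namespace Summit.Ventures.HodgeRepro.Tier4.Line1

open NumberField MeasureTheory Summit.Ventures.HodgeRepro.Tier4.Common Matrix Rot

variable {k : Type} [Field k] [NumberField k] {W : PlaneData k}

/-! ## 1. The pair of scalars of a torus element, read off the conjugated matrix -/

section Pair

/-- the conjugated matrix `S⁻¹ · gᵀ · S` of `g ∈ U(W)(𝔸_k)` in the adapted basis `S` of the torus data `D`
(column picture: for `g = torusElt D ρ` it is `blockScalar d (ρ 0) (ρ 1) (ρ 2) (ρ 3)`) -/
def conjMat (D : TorusData k) (g : GA W) : Matrix (Fin 4) (Fin 4) (Ad k) :=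
  (D.S⁻¹).map (algebraMap k (Ad k)) * (GA.mat W g)ᵀ * D.S.map (algebraMap k (Ad k))

/-- **the pair of scalars `(x, y, x′, y′)` of `g`**, read off `conjMat D g` at the four positions where
`blockScalar d x y x′ y′` carries `x, y, x′, y′` (entries `(0,0)`, `(1,0)`, `(2,2)`, `(3,2)`) -/
def pairOf (D : TorusData k) (g : GA W) : Fin 4 → Ad k :=
  ![conjMat D g 0 0, conjMat D g 1 0, conjMat D g 2 2, conjMat D g 3 2]

/-- the conjugated matrix of a torus element is its block scalar -/
theorem conjMat_torusElt (D : TorusData k) (hDB : D.B = W.B) (hDOm : D.Om = W.Ωᵀ) (ρ : Fin 4 → Ad k)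
    (hρ : TorusData.IsNormOne (algebraMap k (Ad k) D.d) ρ) :
    conjMat D (torusElt D hDB hDOm ρ hρ) =
      blockScalar (algebraMap k (Ad k) D.d) (ρ 0) (ρ 1) (ρ 2) (ρ 3) := by
  obtain ⟨-, hRR', -, -, -, -, -, -⟩ := D.setup (algebraMap k (Ad k))
  rw [conjMat, torusElt_mat, TorusData.tmat_eq_transpose, Matrix.transpose_transpose]
  set A := (D.S⁻¹).map (algebraMap k (Ad k)) with hA
  set S := D.S.map (algebraMap k (Ad k)) with hS
  set Bk := blockScalar (algebraMap k (Ad k) D.d) (ρ 0) (ρ 1) (ρ 2) (ρ 3) with hBk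
  calc A * (S * Bk * A) * S = (A * S) * Bk * (A * S) := by simp only [Matrix.mul_assoc]
    _ = Bk := by rw [hRR', Matrix.one_mul, Matrix.mul_one]

/-- **the pair of a torus element is the pair it was built from** -/
theorem pairOf_torusElt (D : TorusData k) (hDB : D.B = W.B) (hDOm : D.Om = W.Ωᵀ) (ρ : Fin 4 → Ad k)
    (hρ : TorusData.IsNormOne (algebraMap k (Ad k) D.d) ρ) :
    pairOf D (torusElt D hDB hDOm ρ hρ) = ρ := by
  funext i
  fin_cases i <;> simp [pairOf, conjMat_torusElt D hDB hDOm ρ hρ, blockScalar]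

variable {P : Fin 2 → Matrix (Fin 4) (Fin 4) k}

/-- **every element of the torus is the torus element of its own pair** (p5's `exists_pair_of_mem` read through
`pairOf`): for `g` commuting with `P 0`, `pairOf D g` has norm one and `g = torusElt D (pairOf D g)`. -/
theorem eq_torusElt_pairOf (D : TorusData k) (hDB : D.B = W.B) (hDOm : D.Om = W.Ωᵀ) (hDP : D.P = (P 0)ᵀ)
    (g : GA W) (hg0 : g ∈ commutant W (P 0)) :
    ∃ hρ : TorusData.IsNormOne (algebraMap k (Ad k) D.d) (pairOf D g),
      g = torusElt D hDB hDOm (pairOf D g) hρ := by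
  obtain ⟨ρ, hρ, hmat⟩ := exists_pair_of_mem D hDB hDOm hDP g hg0
  have hg : g = torusElt D hDB hDOm ρ hρ := Subtype.ext (Units.ext hmat)
  have hp : pairOf D g = ρ := by rw [hg, pairOf_torusElt]
  refine ⟨hp ▸ hρ, ?_⟩
  apply Subtype.ext
  apply Units.ext
  show GA.mat W g = D.tmat (algebraMap k (Ad k)) (pairOf D g)
  rw [hp]
  exact hmat

/-- the pair of an element of the torus has norm one -/
theorem isNormOne_pairOf (D : TorusData k) (hDB : D.B = W.B) (hDOm : D.Om = W.Ωᵀ) (hDP : D.P = (P 0)ᵀ)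
    (g : GA W) (hg0 : g ∈ commutant W (P 0)) :
    TorusData.IsNormOne (algebraMap k (Ad k) D.d) (pairOf D g) :=
  (eq_torusElt_pairOf D hDB hDOm hDP g hg0).1

/-- **the pair of a product is the componentwise product of the pairs** (`pmul` = `qmul` on each half) -/
theorem pairOf_mul (D : TorusData k) (hDB : D.B = W.B) (hDOm : D.Om = W.Ωᵀ) (hDP : D.P = (P 0)ᵀ)
    (g h : GA W) (hg0 : g ∈ commutant W (P 0)) (hh0 : h ∈ commutant W (P 0)) :
    pairOf D (g * h) = TorusData.pmul (algebraMap k (Ad k) D.d) (pairOf D g) (pairOf D h) := by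
  obtain ⟨hρ, hg⟩ := eq_torusElt_pairOf D hDB hDOm hDP g hg0
  obtain ⟨hρ', hh⟩ := eq_torusElt_pairOf D hDB hDOm hDP h hh0
  conv_lhs => rw [hg, hh, ← torusElt_mul D hDB hDOm _ _ hρ hρ', pairOf_torusElt]

/-- `pairOf` is continuous (the entries of `S⁻¹ gᵀ S` are continuous in `g`) -/
theorem continuous_pairOf (D : TorusData k) : Continuous (pairOf D : GA W → Fin 4 → Ad k) := by
  have hmat : Continuous fun g : GA W => GA.mat W g :=
    Units.continuous_val.comp continuous_subtype_val
  have hconj : Continuous fun g : GA W => conjMat D g := by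
    unfold conjMat
    exact (continuous_const.matrix_mul hmat.matrix_transpose).matrix_mul continuous_const
  refine continuous_pi fun i => ?_
  fin_cases i <;> simp only [pairOf, Matrix.cons_val_zero, Matrix.cons_val_one, Matrix.head_cons,
    Matrix.cons_val_two, Matrix.tail_cons, Matrix.cons_val_three, Fin.isValue, Fin.mk_one,
    Fin.reduceFinMk] <;> exact hconj.matrix_elem _ _

/-- **the pair of a RATIONAL torus element is rational**: `g ∈ U(W)(k)` commuting with `P 0` has
`pairOf D g = (x, y, x′, y′)` with `x, y, x′, y′ ∈ k` of norm one (`torus_scalar_of_isometry` over `k` itself, the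
identities over `k` recovered from the adelic ones by the injectivity of `k → 𝔸_k`). -/
theorem pairOf_rational (D : TorusData k) (hDB : D.B = W.B) (hDOm : D.Om = W.Ωᵀ) (hDP : D.P = (P 0)ᵀ)
    (g : GA W) (hg0 : g ∈ commutant W (P 0)) (hrat : g ∈ rationalPoints W) :
    ∃ ρ₀ : Fin 4 → k, TorusData.IsNormOne D.d ρ₀ ∧ pairOf D g = fun i => algebraMap k (Ad k) (ρ₀ i) := by
  have hinj : Function.Injective (algebraMap k (Ad k)) := AdeleRing.algebraMap_injective (R := 𝓞 k) (K := k)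
  -- the rational matrix `g₀` of `g`
  rw [rationalPoints, Subgroup.mem_subgroupOf, principalGL, MonoidHom.mem_range] at hrat
  obtain ⟨g₀, hg₀⟩ := hrat
  have hmat : ((g : GL4 k) : M4 k) = (g₀ : Matrix (Fin 4) (Fin 4) k).map (algebraMap k (Ad k)) := by
    rw [← hg₀]
    rfl
  -- the three identities over `k`
  have hmapinj : Function.Injective fun M : Matrix (Fin 4) (Fin 4) k => M.map (algebraMap k (Ad k)) :=
    Matrix.map_injective hinj
  have hΩ : (g₀ : Matrix (Fin 4) (Fin 4) k) * W.Ω = W.Ω * g₀ := by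
    apply hmapinj
    have h := ((mem_unitaryGroup W _).mp g.2).1
    simp only [adMat] at h
    rw [hmat] at h
    show ((g₀ : Matrix (Fin 4) (Fin 4) k) * W.Ω).map (algebraMap k (Ad k)) =
      (W.Ω * (g₀ : Matrix (Fin 4) (Fin 4) k)).map (algebraMap k (Ad k))
    simpa only [Matrix.map_mul] using h
  have hB : (g₀ : Matrix (Fin 4) (Fin 4) k) * W.B * (g₀ : Matrix (Fin 4) (Fin 4) k)ᵀ = W.B := by
    apply hmapinj
    have h := ((mem_unitaryGroup W _).mp g.2).2
    simp only [adMat] at h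
    rw [hmat] at h
    show ((g₀ : Matrix (Fin 4) (Fin 4) k) * W.B * (g₀ : Matrix (Fin 4) (Fin 4) k)ᵀ).map (algebraMap k (Ad k)) =
      W.B.map (algebraMap k (Ad k))
    simpa only [Matrix.map_mul, Matrix.transpose_map] using h
  have hP : (g₀ : Matrix (Fin 4) (Fin 4) k) * P 0 = P 0 * g₀ := by
    apply hmapinj
    have h : ((g : GL4 k) : M4 k) * adMat k (P 0) = adMat k (P 0) * ((g : GL4 k) : M4 k) := hg0
    simp only [adMat] at h
    rw [hmat] at h
    show ((g₀ : Matrix (Fin 4) (Fin 4) k) * P 0).map (algebraMap k (Ad k)) =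
      (P 0 * (g₀ : Matrix (Fin 4) (Fin 4) k)).map (algebraMap k (Ad k))
    simpa only [Matrix.map_mul] using h
  -- `torus_scalar_of_isometry` over `k` (`ι = id`) for `M = g₀ᵀ`
  have hid : ∀ A : Matrix (Fin 4) (Fin 4) k, A.map (RingHom.id k) = A := fun A => by
    ext i j
    simp
  have hMOm : (g₀ : Matrix (Fin 4) (Fin 4) k)ᵀ * D.Om.map (RingHom.id k) =
      D.Om.map (RingHom.id k) * (g₀ : Matrix (Fin 4) (Fin 4) k)ᵀ := by
    rw [hid, hDOm, ← Matrix.transpose_mul, ← Matrix.transpose_mul, hΩ]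
  have hMB : ((g₀ : Matrix (Fin 4) (Fin 4) k)ᵀ)ᵀ * D.B.map (RingHom.id k) * (g₀ : Matrix (Fin 4) (Fin 4) k)ᵀ =
      D.B.map (RingHom.id k) := by
    rw [hid, hDB, Matrix.transpose_transpose, hB]
  have hMP : (g₀ : Matrix (Fin 4) (Fin 4) k)ᵀ * D.P.map (RingHom.id k) =
      D.P.map (RingHom.id k) * (g₀ : Matrix (Fin 4) (Fin 4) k)ᵀ := by
    rw [hid, hDP, ← Matrix.transpose_mul, ← Matrix.transpose_mul, hP]
  obtain ⟨x, y, x', y', hxy, hxy', hM⟩ := torus_scalar_of_isometry (RingHom.id k) D.hB D.hherm D.hOm D.hd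
    D.hdef D.hv D.hw D.hwv D.hwOv D.hPv D.hPOv D.hPw D.hPOw hMOm hMB hMP
  simp only [RingHom.id_apply, hid] at hxy hxy' hM
  refine ⟨![x, y, x', y'], ⟨by simpa using hxy, by simpa using hxy'⟩, ?_⟩
  -- the conjugated matrix of `g` is the block scalar of `(x, y, x′, y′)` read in `𝔸_k`
  obtain ⟨-, hRR', -, -, -, -, -, -⟩ := adapted_setup (RingHom.id k) D.hB D.hherm D.hOm D.hd D.hdef D.hv D.hw
    D.hwv D.hwOv D.hPv D.hPOv D.hPw D.hPOw
  simp only [hid] at hRR'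
  have hconj : conjMat D g = (blockScalar D.d x y x' y').map (algebraMap k (Ad k)) := by
    rw [conjMat, GA.mat, hmat, ← Matrix.transpose_map, ← Matrix.map_mul, ← Matrix.map_mul, hM]
    congr 1
    rw [TorusData.S]
    calc (adaptedBasis D.Om D.v D.w)⁻¹ * (adaptedBasis D.Om D.v D.w * blockScalar D.d x y x' y' *
            (adaptedBasis D.Om D.v D.w)⁻¹) * adaptedBasis D.Om D.v D.w
        = ((adaptedBasis D.Om D.v D.w)⁻¹ * adaptedBasis D.Om D.v D.w) * blockScalar D.d x y x' y' *
            ((adaptedBasis D.Om D.v D.w)⁻¹ * adaptedBasis D.Om D.v D.w) := by simp only [Matrix.mul_assoc]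
      _ = blockScalar D.d x y x' y' := by rw [hRR', Matrix.one_mul, Matrix.mul_one]
  funext i
  fin_cases i <;> simp [pairOf, hconj, blockScalar]

/-- **the pair of an `E′_𝔸`-scalar `a·1 + b·Ω` is `(a, b, a, b)`** (`S⁻¹ Ωᵀ S = omegaJ d`, p5's `adapted_setup`) -/
theorem pairOf_of_scalar (D : TorusData k) (hDOm : D.Om = W.Ωᵀ) (g : GA W) {a b : Ad k}
    (hg : GA.mat W g = a • (1 : M4 k) + b • adMat k W.Ω) : pairOf D g = ![a, b, a, b] := by
  set ι := algebraMap k (Ad k) with hι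
  obtain ⟨-, hRR', hOmR, -, -, -, -, -⟩ := D.setup ι
  have hΩ : (adMat k W.Ω)ᵀ = D.Om.map ι := by
    rw [hDOm, adMat, Matrix.transpose_map]
  have hconj : conjMat D g = a • (1 : Matrix (Fin 4) (Fin 4) (Ad k)) + b • omegaJ (ι D.d) := by
    rw [conjMat, hg, Matrix.transpose_add, Matrix.transpose_smul, Matrix.transpose_smul, Matrix.transpose_one, hΩ,
      Matrix.mul_add, Matrix.add_mul, Matrix.mul_smul, Matrix.smul_mul, Matrix.mul_one, hRR', Matrix.mul_smul,
      Matrix.smul_mul, Matrix.mul_assoc, hOmR, ← Matrix.mul_assoc, hRR', Matrix.one_mul]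
  funext i
  fin_cases i <;> simp [pairOf, hconj, omegaJ]

end Pair

end Summit.Ventures.HodgeRepro.Tier4.Line1

end
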